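import Literature.AnabelianGeometry.EtaleTheta.ThetaCoversModelNumerology
import Literature.AnabelianGeometry.EtaleTheta.Discharge.Sec2InertiaBinderOfHat
import HarnessLib

/-!
# [EtTh] §2 over §1: «`I_x ⥲ Δ̄_Θ`» from the COMMUTATOR AXIS — if the cusp inertia is topologically
# generated by `[a,b]` for a topological generating pair `a, b` of `Δ_X`, then `I_x · Ker(Δ_X ↠ Δ̄_X)`
# is the `Δ̄_Θ`-preimage, for every `l > 0`

S. Mochizuki, *The étale theta function and its Frobenioid-theoretic manifestations*, Publ. RIMS **45**
(2009) [EtTh], §1 p. 12 (printed 238): «`Δ_X` … is a profinite free group on `2` generators»; §2,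
discussion preceding Def. 2.1, p. 35 (printed 261): «`Δ^Θ_X` … `1 → Δ_Θ → Δ^Θ_X → Δ^ell_X → 1` … `Δ_Θ ≅
Ẑ(1)`, `[Δ̄_X, Δ̄_X] = Δ̄_Θ ≅ (ℤ/lℤ)(1)`», «`D_x → Π^Θ_X` … maps the inertia group `I_x ⊆ D_x` isomorphically
onto `Δ̄_Θ`» [cite: MochizukiEtTh2009, Def 2.1 p.35].

Cell abc-iut, layer L2, seat abc-iut-L2-t10 (gen 5). GAP-LEDGER G-L2t10-3: the binder `hIx` of
`ThetaSetting.PiCData.coverDataAx` was reduced (`Sec2InertiaBinderOfHat`, p432830) to the §1-side clause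
`toHat(I_x) ⊔ barKerHat l = barThetaHat l` (compact `D_x`). The ORIGIN CLAUSE proposed for the v-next §1
interface (GAP-LEDGER l.273, abc-iut-L6-d6) is the print-shaped one: «for a free profinite basis `a, b` of
`Δ_X` the inertia subgroup of the cusp is topologically generated by `[a,b]`» (the boundary loop of a
once-punctured torus). This PROOF-ONLY file (0 definitions) derives the former from the latter, for EVERY
`l > 0`, by the class-two normal-form argument of this lineage's `IsEtThOrigin.relIndex_barKerHat`
(abc-iut-L2-t10 g4, `ThetaCoversModelNumerology`), now run for an ARBITRARY topological generating pair:

* §1 **`ThetaSetting.barThetaHat_le_zpowers_commutator_sup_barKerHat`**: if `a, b ∈ Δ_X` topologically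
  generate `Δ_X`, then `barThetaHat l ≤ ⟨[a,b]⟩ · barKerHat l` (`Δ_X / barKerHat l` has class `≤ 2`, so
  every commutator of the dense `⟨a,b⟩` is `[a,b]^k` mod `barKerHat`; the finite union of cosets
  `[a,b]^k · barKerHat`, `0 ≤ k < l`, is CLOSED, hence contains all commutators of `Δ_X` and then the
  closure `barThetaHat`); whence `closure⟨[a,b]⟩ ⊔ barKerHat l = barThetaHat l`
  (`closure_zpowers_commutator_sup_barKerHat`);
* §2 **`ThetaSetting.inertiaClause_of_commutatorAxis`**: if `closure(toHat(I_x)) = closure⟨[a,b]⟩` for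
  such a pair, then `closure(toHat(I_x)) ⊔ barKerHat l = barThetaHat l`; for a COMPACT decomposition group
  (`toHat(I_x)` closed) `toHat(I_x) ⊔ barKerHat l = barThetaHat l`, and so
  **`PiCData.inertia_sup_barKer_of_commutatorAxis`**: the binder `hIx` of `coverDataAx` HOLDS for every
  `I : D.PiCData PiC` — «`I_x ⥲ Δ̄_Θ`» DERIVED from the commutator-axis clause.

No free universal property is needed (only topological generation); `a, b` are arbitrary. Nothing of
[EtTh] is asserted: the commutator-axis clause is a HYPOTHESIS (no model in the tree satisfies it — the
χ-model's synthetic cusp is toral, `SettingModelCuspAxis`); no new `Prop` fact; zero edit of any other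
seat's file; no side is taken on [IUTchIII] Cor. 3.12; typed ≠ proved.
-/

noncomputable section

namespace Literature.AnabelianGeometry.EtaleTheta

open scoped commutatorElement
open _root_.Topology Literature.AnabelianGeometry.SemiGraphs ClassTwo DtpYAbelian

namespace ThetaSetting

variable {p : ℕ} [Fact p.Prime] (D : ThetaSetting p) (l : ℕ)

/-! ## §1. `barThetaHat = ⟨[a,b]⟩⁻ · barKerHat` for any topological generating pair `a, b` of `Δ_X` -/

/-- **Class-two normal forms**: if `a, b ∈ Δ_X` topologically generate `Δ_X` and `l > 0`, then the
`Δ̄_Θ`-preimage lies in `⟨[a,b]⟩ · Ker(Δ_X ↠ Δ̄_X)`: every commutator of the dense subgroup `⟨a,b⟩` is a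
power of `[a,b]` modulo the class-`3`/`l`-power kernel, the union of the `l` cosets `[a,b]^k · barKerHat`
is closed, and `barThetaHat` is the closure of `[Δ_X,Δ_X] · Δ_X^l`. (The argument of
`IsEtThOrigin.relIndex_barKerHat`, for an arbitrary pair.) [cite: MochizukiEtTh2009, Def 2.1 p.35] -/
theorem barThetaHat_le_zpowers_commutator_sup_barKerHat (hl : 0 < l) {a b : D.DeltaHat}
    (hdense : (Subgroup.closure ({a, b} : Set D.DeltaHat)).topologicalClosure = ⊤) :
    D.barThetaHat l ≤ Subgroup.zpowers (⁅(a : D.PiHat), (b : D.PiHat)⁆) ⊔ D.barKerHat l := by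
  classical
  haveI : T2Space D.PiHat := D.isProfiniteCompletion_toHat.t2Space
  haveI hKn : (D.barKerHat l).Normal := D.barKerHat_normal l
  have hKclosed : IsClosed (D.barKerHat l : Set D.PiHat) := D.isClosed_barKerHat l
  set c : D.PiHat := ⁅(a : D.PiHat), (b : D.PiHat)⁆ with hcdef
  have hcΔ : c ∈ D.DeltaHat := by
    rw [hcdef, commutatorElement_def]
    exact D.DeltaHat.mul_mem (D.DeltaHat.mul_mem (D.DeltaHat.mul_mem a.2 b.2)
      (D.DeltaHat.inv_mem a.2)) (D.DeltaHat.inv_mem b.2)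
  have hcl : c ^ l ∈ D.barKerHat l := D.pow_mem_barKerHat l hcΔ
  -- ### `U := c^ℤ · barKerHat`, a closed subgroup of `Π_X`
  let U : Subgroup D.PiHat :=
    { carrier := {g | ∃ k : ℤ, ∃ m ∈ D.barKerHat l, g = c ^ k * m}
      one_mem' := ⟨0, 1, one_mem _, by simp⟩
      mul_mem' := by
        rintro _ _ ⟨k, m, hm, rfl⟩ ⟨k', m', hm', rfl⟩
        refine ⟨k + k', (c ^ k')⁻¹ * m * c ^ k' * m', (D.barKerHat l).mul_mem ?_ hm', ?_⟩
        · simpa using hKn.conj_mem m hm (c ^ k')⁻¹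
        · rw [zpow_add]; group
      inv_mem' := by
        rintro _ ⟨k, m, hm, rfl⟩
        refine ⟨-k, c ^ k * m⁻¹ * (c ^ k)⁻¹, hKn.conj_mem _ ((D.barKerHat l).inv_mem hm) _, ?_⟩
        rw [zpow_neg]; group }
  have hU_mem : ∀ g, g ∈ U ↔ ∃ k : ℤ, ∃ m ∈ D.barKerHat l, g = c ^ k * m := fun g => Iff.rfl
  have hKU : D.barKerHat l ≤ U := fun m hm => ⟨0, m, hm, by simp⟩
  have hUle : U ≤ Subgroup.zpowers c ⊔ D.barKerHat l := by
    rintro _ ⟨k, m, hm, rfl⟩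
    exact Subgroup.mul_mem_sup (Subgroup.zpow_mem_zpowers c k) hm
  -- closedness: `U` is the finite union of the closed cosets `c^k · barKer`, `0 ≤ k < l`
  have hUclosed : IsClosed (U : Set D.PiHat) := by
    have hcl' : c ^ (l : ℤ) ∈ D.barKerHat l := by rw [zpow_natCast]; exact hcl
    have hl0' : (l : ℤ) ≠ 0 := by exact_mod_cast hl.ne'
    have hcover : (U : Set D.PiHat) =
        ⋃ k ∈ Finset.range l, (fun m : D.PiHat => c ^ (k : ℤ) * m) '' (D.barKerHat l : Set D.PiHat) := by
      ext g
      simp only [SetLike.mem_coe, hU_mem, Set.mem_iUnion, Set.mem_image, Finset.mem_range]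
      constructor
      · rintro ⟨k, m, hm, rfl⟩
        refine ⟨(k % l).toNat, ?_, (c ^ (l : ℤ)) ^ (k / l) * m,
          (D.barKerHat l).mul_mem (Subgroup.zpow_mem _ hcl' _) hm, ?_⟩
        · have := Int.emod_lt_of_pos k (by exact_mod_cast hl : (0 : ℤ) < l)
          have h0 := Int.emod_nonneg k hl0'
          omega
        · have hk : c ^ k = c ^ ((k % l).toNat : ℤ) * (c ^ (l : ℤ)) ^ (k / l) := by
            rw [Int.toNat_of_nonneg (Int.emod_nonneg k hl0'), ← zpow_mul, ← zpow_add]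
            congr 1
            exact (Int.emod_add_mul_ediv _ _).symm
          rw [hk, mul_assoc]
      · rintro ⟨k, -, m, hm, rfl⟩
        exact ⟨k, m, hm, rfl⟩
    rw [hcover]
    refine isClosed_biUnion_finset fun k _ => ?_
    exact (Homeomorph.mulLeft (c ^ (k : ℤ))).isClosedMap _ hKclosed
  -- commutators of elements of the dense `⟨a, b⟩` lie in `U` (class-two normal forms modulo `barKer`)
  have hU_comm_gen : ∀ u ∈ Subgroup.closure ({a, b} : Set D.DeltaHat),
      ∀ v ∈ Subgroup.closure ({a, b} : Set D.DeltaHat), ⁅(u : D.PiHat), (v : D.PiHat)⁆ ∈ U := by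
    intro u hu v hv
    let π : D.PiHat →* D.PiHat ⧸ D.barKerHat l := QuotientGroup.mk' (D.barKerHat l)
    let A : Subgroup (D.PiHat ⧸ D.barKerHat l) :=
      ((Subgroup.closure ({a, b} : Set D.DeltaHat)).map D.DeltaHat.subtype).map π
    have hAgen : A = Subgroup.closure ({π a, π b} : Set (D.PiHat ⧸ D.barKerHat l)) := by
      simp only [A, MonoidHom.map_closure, Set.image_pair, Subgroup.coe_subtype]
    have hAle : A ≤ (D.DeltaHat.map π) := Subgroup.map_mono (Subgroup.map_subtype_le _)
    have h3 : ⁅⁅A, A⁆, A⁆ = ⊥ := by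
      rw [eq_bot_iff]
      calc ⁅⁅A, A⁆, A⁆ ≤ ⁅⁅D.DeltaHat.map π, D.DeltaHat.map π⁆, D.DeltaHat.map π⁆ :=
            Subgroup.commutator_mono (Subgroup.commutator_mono hAle hAle) hAle
        _ = (⁅⁅D.DeltaHat, D.DeltaHat⁆, D.DeltaHat⁆).map π := by
            rw [Subgroup.map_commutator, Subgroup.map_commutator]
        _ ≤ (D.barKerHat l).map π := Subgroup.map_mono (D.tripleCommutator_le_barKerHat l)
        _ = ⊥ := by
            rw [eq_bot_iff]
            rintro _ ⟨k, hk, rfl⟩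
            exact (QuotientGroup.eq_one_iff k).mpr hk
    have hαA : π a ∈ A := by rw [hAgen]; exact Subgroup.subset_closure (Set.mem_insert _ _)
    have hβA : π b ∈ A := by
      rw [hAgen]; exact Subgroup.subset_closure (Set.mem_insert_of_mem _ (Set.mem_singleton _))
    have hcyc := commutator_le_zpowers_of_classTwo A hαA hβA hAgen.le h3
    have huA : π u ∈ A := ⟨u, ⟨u, hu, rfl⟩, rfl⟩
    have hvA : π v ∈ A := ⟨v, ⟨v, hv, rfl⟩, rfl⟩
    have hmem : ⁅π u, π v⁆ ∈ Subgroup.zpowers ⁅π a, π b⁆ :=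
      hcyc (Subgroup.commutator_mem_commutator huA hvA)
    obtain ⟨m, hm⟩ := Subgroup.mem_zpowers_iff.mp hmem
    rw [← map_commutatorElement, ← map_commutatorElement, ← hcdef, ← map_zpow] at hm
    have hk : (c ^ m)⁻¹ * ⁅(u : D.PiHat), (v : D.PiHat)⁆ ∈ D.barKerHat l := by
      rw [← QuotientGroup.eq]; exact hm
    exact ⟨m, _, hk, by rw [mul_inv_cancel_left]⟩
  -- all commutators of `Δ_X` lie in `U` (density of `⟨a, b⟩`, closedness of `U`)
  have hU_comm : ⁅D.DeltaHat, D.DeltaHat⁆ ≤ U := by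
    refine Subgroup.commutator_le.mpr fun u hu v hv => ?_
    let T : Set (D.DeltaHat × D.DeltaHat) :=
      {q | ⁅((q.1 : D.DeltaHat) : D.PiHat), ((q.2 : D.DeltaHat) : D.PiHat)⁆ ∈ U}
    have hTclosed : IsClosed T := by
      refine hUclosed.preimage ?_
      have h1 : Continuous fun q : D.DeltaHat × D.DeltaHat => ((q.1 : D.DeltaHat) : D.PiHat) :=
        continuous_subtype_val.comp continuous_fst
      have h2 : Continuous fun q : D.DeltaHat × D.DeltaHat => ((q.2 : D.DeltaHat) : D.PiHat) :=
        continuous_subtype_val.comp continuous_snd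
      simp only [commutatorElement_def]
      exact ((h1.mul h2).mul h1.inv).mul h2.inv
    have hAdense : Dense ((Subgroup.closure ({a, b} : Set D.DeltaHat) : Subgroup D.DeltaHat) :
        Set D.DeltaHat) := by
      rw [dense_iff_closure_eq, ← Subgroup.topologicalClosure_coe, hdense, Subgroup.coe_top]
    have hsub : ((Subgroup.closure ({a, b} : Set D.DeltaHat) : Set D.DeltaHat) ×ˢ
        (Subgroup.closure ({a, b} : Set D.DeltaHat) : Set D.DeltaHat)) ⊆ T := by
      rintro ⟨u', v'⟩ ⟨hu', hv'⟩
      exact hU_comm_gen u' hu' v' hv'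
    have hT : T = Set.univ := by
      refine Set.eq_univ_of_univ_subset ?_
      rw [← (hAdense.prod hAdense).closure_eq]
      exact hTclosed.closure_subset_iff.mpr hsub
    have : ((⟨u, hu⟩ : D.DeltaHat), (⟨v, hv⟩ : D.DeltaHat)) ∈ T := by rw [hT]; trivial
    exact this
  have hΘU : D.barThetaHat l ≤ U :=
    Subgroup.topologicalClosure_minimal _ (sup_le hU_comm ((D.deltaHatPow_le_barKerHat l).trans hKU))
      hUclosed
  exact hΘU.trans hUle

/-- **`⟨[a,b]⟩⁻ · Ker(Δ_X ↠ Δ̄_X) = Δ̄_Θ`-preimage** for any topological generating pair `a, b` of `Δ_X`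
and `l > 0` («`[Δ̄_X, Δ̄_X] = Δ̄_Θ`», generated by the class of `[a,b]`). [cite: MochizukiEtTh2009, Def 2.1 p.35] -/
theorem closure_zpowers_commutator_sup_barKerHat (hl : 0 < l) {a b : D.DeltaHat}
    (hdense : (Subgroup.closure ({a, b} : Set D.DeltaHat)).topologicalClosure = ⊤) :
    (Subgroup.zpowers (⁅(a : D.PiHat), (b : D.PiHat)⁆)).topologicalClosure ⊔ D.barKerHat l =
      D.barThetaHat l := by
  refine le_antisymm (sup_le ?_ (D.barKerHat_le_barThetaHat l)) ?_
  · refine Subgroup.topologicalClosure_minimal _ ?_ (D.isClosed_barThetaHat l)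
    rw [Subgroup.zpowers_le]
    exact D.commutator_le_barThetaHat l (Subgroup.commutator_mem_commutator a.2 b.2)
  · exact (D.barThetaHat_le_zpowers_commutator_sup_barKerHat l hl hdense).trans
      (sup_le_sup_right (Subgroup.le_topologicalClosure _) _)

/-! ## §2. The inertia clause from the commutator axis -/

/-- **«`I_x ⥲ Δ̄_Θ`» from the commutator axis**, closure form: if the closure of `toHat(I_x)` is the
closed procyclic subgroup `⟨[a,b]⟩⁻` for a topological generating pair `a, b` of `Δ_X` (the boundary loop
of the once-punctured torus), then `closure(toHat(I_x)) ⊔ barKerHat l = barThetaHat l` for every `l > 0`.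
[cite: MochizukiEtTh2009, Def 2.1 p.35] -/
theorem inertiaClause_closure_of_commutatorAxis (hl : 0 < l) (x : D.Pt) {a b : D.DeltaHat}
    (hdense : (Subgroup.closure ({a, b} : Set D.DeltaHat)).topologicalClosure = ⊤)
    (hI : ((D.inertia x).map D.toHat.toMonoidHom).topologicalClosure =
      (Subgroup.zpowers (⁅(a : D.PiHat), (b : D.PiHat)⁆)).topologicalClosure) :
    ((D.inertia x).map D.toHat.toMonoidHom).topologicalClosure ⊔ D.barKerHat l = D.barThetaHat l := by
  rw [hI]
  exact D.closure_zpowers_commutator_sup_barKerHat l hl hdense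

/-- The inertia subgroup `I_x = D_x ∩ Δ^tp_X` is closed in `Π^tp_X`. [cite: MochizukiEtTh2009, Def 2.1 p.35] -/
theorem isClosed_inertia (x : D.Pt) : IsClosed (D.inertia x : Set D.PiTemp) := by
  change IsClosed ((D.decomp x : Set D.PiTemp) ∩ (D.aug.toMonoidHom.ker : Set D.PiTemp))
  refine (D.isClosed_decomp x).inter ?_
  have h1 : ((D.aug.toMonoidHom.ker : Subgroup D.PiTemp) : Set D.PiTemp) = D.aug ⁻¹' {1} := by
    ext g; exact MonoidHom.mem_ker
  rw [h1]
  exact (isClosed_singleton.preimage D.aug.continuous)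

/-- For a COMPACT decomposition group, `toHat(I_x)` is closed in `Π_X` (`I_x` is closed in the compact
`D_x`, so compact; `Π_X` is Hausdorff). [cite: MochizukiEtTh2009, Def 2.1 p.35] -/
theorem closure_map_inertia_eq_of_isCompact (x : D.Pt) (hcpt : IsCompact (D.decomp x : Set D.PiTemp)) :
    ((D.inertia x).map D.toHat.toMonoidHom).topologicalClosure = (D.inertia x).map D.toHat.toMonoidHom := by
  haveI : T2Space D.PiHat := D.isProfiniteCompletion_toHat.t2Space
  have hI : IsCompact (D.inertia x : Set D.PiTemp) :=
    hcpt.of_isClosed_subset (D.isClosed_inertia x) fun g hg => hg.1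
  refine le_antisymm (Subgroup.topologicalClosure_minimal _ le_rfl ?_) (Subgroup.le_topologicalClosure _)
  rw [Subgroup.coe_map]
  exact (hI.image D.toHat.continuous).isClosed

/-- **«`I_x ⥲ Δ̄_Θ`» from the commutator axis**, compact form: for a compact decomposition group whose
inertia `toHat(I_x)` is `⟨[a,b]⟩⁻` for a topological generating pair `a, b` of `Δ_X`,
`toHat(I_x) ⊔ barKerHat l = barThetaHat l` for every `l > 0` — the §1-side clause of
`Sec2InertiaBinderOfHat`. [cite: MochizukiEtTh2009, Def 2.1 p.35] -/
theorem inertiaClause_of_commutatorAxis (hl : 0 < l) (x : D.Pt) (hcpt : IsCompact (D.decomp x : Set D.PiTemp))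
    {a b : D.DeltaHat} (hdense : (Subgroup.closure ({a, b} : Set D.DeltaHat)).topologicalClosure = ⊤)
    (hI : (D.inertia x).map D.toHat.toMonoidHom =
      (Subgroup.zpowers (⁅(a : D.PiHat), (b : D.PiHat)⁆)).topologicalClosure) :
    (D.inertia x).map D.toHat.toMonoidHom ⊔ D.barKerHat l = D.barThetaHat l := by
  have h := D.inertiaClause_closure_of_commutatorAxis l hl x hdense
    (by rw [D.closure_map_inertia_eq_of_isCompact x hcpt, hI])
  rwa [D.closure_map_inertia_eq_of_isCompact x hcpt] at h

namespace PiCData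

variable {D} {PiC : Type} [Group PiC] [TopologicalSpace PiC] [IsTopologicalGroup PiC] [T2Space PiC]
  (I : D.PiCData PiC)

/-- **The binder `hIx` of `coverDataAx` DERIVED from the commutator-axis clause**: for every profinite
input bundle `I : D.PiCData PiC`, a cusp `x` with compact decomposition group whose inertia `toHat(I_x)`
is `⟨[a,b]⟩⁻` for a topological generating pair `a, b` of `Δ_X`, and every `l > 0`:
`(D_x ∩ Δ_C) · barKer l = barTheta l` inside `Π_C`. [cite: MochizukiEtTh2009, Def 2.1 p.35] -/
theorem inertia_sup_barKer_of_commutatorAxis (l : ℕ) (hl : 0 < l) (e : D.OncePuncturedData) (x : D.Pt)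
    (hcpt : IsCompact (D.decomp x : Set D.PiTemp)) {a b : D.DeltaHat}
    (hdense : (Subgroup.closure ({a, b} : Set D.DeltaHat)).topologicalClosure = ⊤)
    (hI : (D.inertia x).map D.toHat.toMonoidHom =
      (Subgroup.zpowers (⁅(a : D.PiHat), (b : D.PiHat)⁆)).topologicalClosure) :
    (I.Dx x ⊓ I.augGK.ker) ⊔ I.barKer l = I.barTheta l :=
  I.inertia_sup_barKer_of_inertia l e x hcpt (D.inertiaClause_of_commutatorAxis l hl x hcpt hdense hI)

end PiCData

end ThetaSetting

end Literature.AnabelianGeometry.EtaleTheta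

end
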